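import Mathlib

/-!
# Lowest-weight modules of an `sl₂`-triple: the weights `μ, μ + 2, μ + 4, …`, each once

Tier-5 support (N4.3 = (R3), route/T5-N4-p5.md v10 step (P2′); route/T5-SUPPORT-p1.md §S4 rows
«the SO(2)-weights are exactly {3, 5, 7, …}, each once» and «Bargmann's list: weights bounded
below starting at 3 ⇒ π₃⁺»).  The printed input behind those rows (Bargmann's classification;
the `K`-types `m + 1, m + 3, …` of the discrete series, Borel *Automorphic forms on SL₂(ℝ)*
§15.10 as located by lit-1) stays a [C] row.  THIS file proves the purely ALGEBRAIC statement
underneath it, for Mathlib's `IsSl2Triple`: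

* a **lowest-weight vector** of weight `μ` is an `m ≠ 0` with `⁅f, m⁆ = 0` and `⁅h, m⁆ = μ • m`
  (`HasLowestWeightVector`); it is a primitive vector of weight `-μ` for the symmetric triple
  `(-h, f, e)` (`HasLowestWeightVector.symm`), which transports Mathlib's string identities;
* the **e-string** `eⁿ m` satisfies `⁅h, eⁿ m⁆ = (μ + 2n) • eⁿ m` (`lie_h_pow`) and
  `⁅f, eⁿ⁺¹ m⁆ = (n + 1)(−μ − n) • eⁿ m` (`lie_f_pow_succ`);
* if `μ` is not a non-positive integer, every `eⁿ m` is non-zero (`pow_e_ne_zero`), the `eⁿ m`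
  are linearly independent `h`-eigenvectors (`hasEigenvector_pow_e`, `linearIndependent_pow_e`),
  and their span `eString` is stable under the Lie subalgebra spanned by the triple
  (`lie_mem_eString_of_mem_toLieSubalgebra`);
* if moreover `M` is irreducible and the triple spans `L`, the span is everything
  (`eString_eq_top`), the `eⁿ m` form a basis (`eStringBasis`), the `h`-eigenspace of `μ + 2n`
  is the line `K ∙ eⁿ m` (`eigenspace_eq_span_singleton`), every other eigenspace is `⊥`
  (`eigenspace_eq_bot`), every eigenspace has dimension `≤ 1` (`finrank_eigenspace_le_one`) and
  the eigenvalues are exactly the `μ + 2n` (`hasEigenvalue_iff`); for `μ = 3` they are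
  `3, 5, 7, …` (`hasEigenvalue_iff_of_three`);
* conversely a non-zero `h`-eigenvector whose weight minus two is not an eigenvalue is a
  lowest-weight vector (`hasLowestWeightVector_of_eigenspace_sub_two_eq_bot`; «weights bounded
  below» gives the lowest-weight vector); `e` raises, `f` lowers the weight by two.

What this file does NOT say: that the `K`-finite vectors of the discrete series `π₃⁺` of
`U(1,1)` form an irreducible `(𝔤, K)`-module with a lowest-weight vector of weight `3`, nor that
the `h`-eigenvalues are the `SO(2)`-weights of (P2′) — the printed inputs of (P2′), [C] as before.

Blind lane: Mathlib only; no sorry; axioms ⊆ {propext, Classical.choice, Quot.sound}.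
-/

namespace Summit.Ventures.HodgeRepro2.T5Sl2LowestWeight

open LieModule Module

section General

variable {R L M : Type*} [CommRing R] [LieRing L] [LieAlgebra R L]
  [AddCommGroup M] [Module R M] [LieRingModule L M] [LieModule R L M]
variable {h e f : L}

/-- A **lowest-weight vector** of weight `μ` for the `sl₂`-triple `(h, e, f)`: a non-zero `m`
killed by `f` and an `h`-eigenvector of eigenvalue `μ` (the mirror image of Mathlib's
`IsSl2Triple.HasPrimitiveVectorWith`, where `e` kills `m`). -/
structure HasLowestWeightVector (t : IsSl2Triple h e f) (m : M) (μ : R) : Prop where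
  /-- the vector is non-zero -/
  ne_zero : m ≠ 0
  /-- `h` acts by the weight `μ` -/
  lie_h : ⁅h, m⁆ = μ • m
  /-- `f` kills the vector -/
  lie_f : ⁅f, m⁆ = 0

/-- `e` raises the `h`-weight by two: `⁅e, ·⁆` maps the `h`-eigenspace of `c` into that of
`c + 2`. -/
lemma lie_e_mem_eigenspace (t : IsSl2Triple h e f) {c : R} {v : M}
    (hv : v ∈ (toEnd R L M h).eigenspace c) :
    ⁅e, v⁆ ∈ (toEnd R L M h).eigenspace (c + 2) := by
  rw [Module.End.mem_eigenspace_iff, toEnd_apply_apply] at hv ⊢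
  rw [leibniz_lie, IsSl2Triple.lie_h_e_smul R t, hv, smul_lie, lie_smul, add_smul, add_comm]

/-- `f` lowers the `h`-weight by two: `⁅f, ·⁆` maps the `h`-eigenspace of `c` into that of
`c - 2`. -/
lemma lie_f_mem_eigenspace (t : IsSl2Triple h e f) {c : R} {v : M}
    (hv : v ∈ (toEnd R L M h).eigenspace c) :
    ⁅f, v⁆ ∈ (toEnd R L M h).eigenspace (c - 2) := by
  rw [Module.End.mem_eigenspace_iff, toEnd_apply_apply] at hv ⊢
  rw [leibniz_lie, IsSl2Triple.lie_lie_smul_f R t, hv, neg_lie, smul_lie, lie_smul, sub_smul,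
    neg_add_eq_sub]

/-- A non-zero `h`-eigenvector of weight `c` such that `c - 2` is not an eigenvalue is a
lowest-weight vector («weights bounded below» produces the lowest-weight vector). -/
lemma hasLowestWeightVector_of_eigenspace_sub_two_eq_bot (t : IsSl2Triple h e f) {c : R} {v : M}
    (hv : (toEnd R L M h).HasEigenvector c v)
    (hbot : (toEnd R L M h).eigenspace (c - 2) = ⊥) :
    HasLowestWeightVector t v c where
  ne_zero := hv.2
  lie_h := by
    have := hv.apply_eq_smul
    rwa [toEnd_apply_apply] at this
  lie_f := by
    have := lie_f_mem_eigenspace t hv.1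
    rwa [hbot, Submodule.mem_bot] at this

namespace HasLowestWeightVector

variable {t : IsSl2Triple h e f} {m : M} {μ : R}

omit [LieAlgebra R L] [LieModule R L M] in
/-- A lowest-weight vector of weight `μ` for `(h, e, f)` is a primitive vector of weight `-μ`
for the symmetric triple `(-h, f, e)`. -/
lemma symm (P : HasLowestWeightVector t m μ) : t.symm.HasPrimitiveVectorWith m (-μ) where
  ne_zero := P.ne_zero
  lie_h := by rw [neg_lie, P.lie_h, neg_smul]
  lie_e := P.lie_f

/-- `⁅h, eⁿ m⁆ = (μ + 2n) • eⁿ m`. -/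
lemma lie_h_pow (P : HasLowestWeightVector t m μ) (n : ℕ) :
    ⁅h, (toEnd R L M e ^ n) m⁆ = (μ + 2 * n) • (toEnd R L M e ^ n) m :=
  t.lie_h_pow_toEnd_e P.lie_h n

/-- `⁅f, eⁿ⁺¹ m⁆ = (n + 1)(−μ − n) • eⁿ m`. -/
lemma lie_f_pow_succ (P : HasLowestWeightVector t m μ) (n : ℕ) :
    ⁅f, (toEnd R L M e ^ (n + 1)) m⁆ = ((n + 1) * (-μ - n)) • (toEnd R L M e ^ n) m :=
  P.symm.lie_e_pow_succ_toEnd_f n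

/-- `⁅f, e⁰ m⁆ = 0`. -/
lemma lie_f_pow_zero (P : HasLowestWeightVector t m μ) : ⁅f, (toEnd R L M e ^ 0) m⁆ = 0 := by
  simpa using P.lie_f

/-- `eⁿ m` is an `h`-eigenvector of eigenvalue `μ + 2n` (possibly zero). -/
lemma pow_e_mem_eigenspace (P : HasLowestWeightVector t m μ) (n : ℕ) :
    ((toEnd R L M e ^ n) m) ∈ (toEnd R L M h).eigenspace (μ + 2 * n) := by
  rw [Module.End.mem_eigenspace_iff, toEnd_apply_apply]
  exact P.lie_h_pow n

end HasLowestWeightVector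

end General

section Field

variable {K L M : Type*} [Field K] [LieRing L] [LieAlgebra K L]
  [AddCommGroup M] [Module K M] [LieRingModule L M] [LieModule K L M]
variable {h e f : L}

/-- The scalar `(n + 1)(−μ − n)` of `lie_f_pow_succ` is non-zero when `μ` is not a
non-positive integer. -/
lemma coeff_ne_zero [CharZero K] {μ : K} (hμ : ∀ n : ℕ, μ ≠ -(n : K)) (n : ℕ) :
    ((n : K) + 1) * (-μ - n) ≠ 0 := by
  refine mul_ne_zero (Nat.cast_add_one_ne_zero n) fun hc => hμ n ?_
  linear_combination -hc

/-- `n ↦ μ + 2n` is injective in characteristic zero. -/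
lemma weight_injective [CharZero K] (μ : K) :
    Function.Injective (fun n : ℕ => μ + 2 * (n : K)) := by
  intro a b hab
  have h2 : (2 : K) * a = 2 * b := add_left_cancel hab
  exact_mod_cast mul_left_cancel₀ two_ne_zero h2

/-- `μ = k + 1` with `k` a natural number is not a non-positive integer. -/
lemma natCast_add_one_ne_neg [CharZero K] (k n : ℕ) : ((k : K) + 1) ≠ -(n : K) := by
  intro hk
  have h0 : ((k + 1 + n : ℕ) : K) = 0 := by push_cast; linear_combination hk
  have := Nat.cast_eq_zero.mp h0
  omega

/-- `3` is not a non-positive integer. -/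
lemma three_ne_neg [CharZero K] (n : ℕ) : (3 : K) ≠ -(n : K) := by
  have := natCast_add_one_ne_neg (K := K) 2 n
  rwa [show ((2 : ℕ) : K) + 1 = 3 by norm_num] at this

/-- The **e-string span** `span K {eⁿ m : n ∈ ℕ}`. -/
def eString (e : L) (m : M) : Submodule K M :=
  Submodule.span K (Set.range fun n : ℕ => ((toEnd K L M e) ^ n) m)

variable {m : M}

/-- `eⁿ m` lies in the e-string span. -/
lemma pow_e_mem_eString (n : ℕ) : ((toEnd K L M e ^ n) m) ∈ eString (K := K) e m :=
  Submodule.subset_span ⟨n, rfl⟩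

/-- `m = e⁰ m` lies in the e-string span. -/
lemma mem_eString (e : L) (m : M) : m ∈ eString (K := K) e m := by
  simpa using pow_e_mem_eString (K := K) (e := e) (m := m) 0

/-- `⁅e, ·⁆` preserves the e-string span. -/
lemma lie_e_mem_eString {v : M} (hv : v ∈ eString (K := K) e m) :
    ⁅e, v⁆ ∈ eString (K := K) e m := by
  have hmap : Submodule.map (toEnd K L M e) (eString (K := K) e m) ≤ eString (K := K) e m := by
    rw [eString, Submodule.map_span_le]
    rintro _ ⟨n, rfl⟩
    rw [toEnd_apply_apply, IsSl2Triple.lie_e_pow_toEnd_e]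
    exact pow_e_mem_eString (n + 1)
  simpa using hmap (Submodule.mem_map_of_mem (f := toEnd K L M e) hv)

namespace HasLowestWeightVector

variable {t : IsSl2Triple h e f} {μ : K}

/-- Every vector of the e-string is non-zero when `μ` is not a non-positive integer. -/
lemma pow_e_ne_zero [CharZero K] (P : HasLowestWeightVector t m μ)
    (hμ : ∀ n : ℕ, μ ≠ -(n : K)) (n : ℕ) :
    ((toEnd K L M e ^ n) m) ≠ 0 := by
  induction n with
  | zero => simpa using P.ne_zero
  | succ n ih =>
    intro hzero
    have h1 := P.lie_f_pow_succ n
    rw [hzero, lie_zero] at h1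
    exact ih ((smul_eq_zero.mp h1.symm).resolve_left (coeff_ne_zero hμ n))

/-- `eⁿ m` is a (non-zero) `h`-eigenvector of eigenvalue `μ + 2n`. -/
lemma hasEigenvector_pow_e [CharZero K] (P : HasLowestWeightVector t m μ)
    (hμ : ∀ n : ℕ, μ ≠ -(n : K)) (n : ℕ) :
    (toEnd K L M h).HasEigenvector (μ + 2 * n) ((toEnd K L M e ^ n) m) :=
  ⟨P.pow_e_mem_eigenspace n, P.pow_e_ne_zero hμ n⟩

/-- The e-string is linearly independent (eigenvectors of the distinct eigenvalues
`μ + 2n`). -/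
lemma linearIndependent_pow_e [CharZero K] (P : HasLowestWeightVector t m μ)
    (hμ : ∀ n : ℕ, μ ≠ -(n : K)) :
    LinearIndependent K (fun n : ℕ => (toEnd K L M e ^ n) m) :=
  (toEnd K L M h).eigenvectors_linearIndependent' (fun n : ℕ => μ + 2 * (n : K))
    (weight_injective μ) _ (P.hasEigenvector_pow_e hμ)

/-- `⁅h, ·⁆` preserves the e-string span. -/
lemma lie_h_mem_eString (P : HasLowestWeightVector t m μ) {v : M}
    (hv : v ∈ eString (K := K) e m) : ⁅h, v⁆ ∈ eString (K := K) e m := by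
  have hmap : Submodule.map (toEnd K L M h) (eString (K := K) e m) ≤ eString (K := K) e m := by
    rw [eString, Submodule.map_span_le]
    rintro _ ⟨n, rfl⟩
    rw [toEnd_apply_apply, P.lie_h_pow n]
    exact Submodule.smul_mem _ _ (pow_e_mem_eString n)
  simpa using hmap (Submodule.mem_map_of_mem (f := toEnd K L M h) hv)

/-- `⁅f, ·⁆` preserves the e-string span. -/
lemma lie_f_mem_eString (P : HasLowestWeightVector t m μ) {v : M}
    (hv : v ∈ eString (K := K) e m) : ⁅f, v⁆ ∈ eString (K := K) e m := by
  have hmap : Submodule.map (toEnd K L M f) (eString (K := K) e m) ≤ eString (K := K) e m := by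
    rw [eString, Submodule.map_span_le]
    rintro _ ⟨n, rfl⟩
    rw [toEnd_apply_apply]
    rcases n with _ | n
    · rw [P.lie_f_pow_zero]
      exact Submodule.zero_mem _
    · rw [P.lie_f_pow_succ n]
      exact Submodule.smul_mem _ _ (pow_e_mem_eString n)
  simpa using hmap (Submodule.mem_map_of_mem (f := toEnd K L M f) hv)

/-- The e-string span is stable under the Lie subalgebra spanned by the triple. -/
lemma lie_mem_eString_of_mem_toLieSubalgebra (P : HasLowestWeightVector t m μ) {x : L}
    (hx : x ∈ t.toLieSubalgebra K) {v : M} (hv : v ∈ eString (K := K) e m) :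
    ⁅x, v⁆ ∈ eString (K := K) e m := by
  obtain ⟨c₁, c₂, c₃, rfl⟩ := (IsSl2Triple.mem_toLieSubalgebra_iff (R := K)).mp hx
  rw [t.lie_e_f, add_lie, add_lie, smul_lie, smul_lie, smul_lie]
  exact Submodule.add_mem _
    (Submodule.add_mem _ (Submodule.smul_mem _ _ (lie_e_mem_eString hv))
      (Submodule.smul_mem _ _ (P.lie_f_mem_eString hv)))
    (Submodule.smul_mem _ _ (P.lie_h_mem_eString hv))

/-- The e-string span as a **Lie submodule**, when the triple spans `L`. -/
def eStringLieSubmodule (P : HasLowestWeightVector t m μ) (hL : t.toLieSubalgebra K = ⊤) :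
    LieSubmodule K L M where
  __ := eString (K := K) e m
  lie_mem {x _} hv :=
    P.lie_mem_eString_of_mem_toLieSubalgebra (by rw [hL]; exact LieSubalgebra.mem_top x) hv

/-- The underlying submodule of `eStringLieSubmodule` is `eString`. -/
lemma coe_eStringLieSubmodule (P : HasLowestWeightVector t m μ)
    (hL : t.toLieSubalgebra K = ⊤) :
    (P.eStringLieSubmodule hL : Submodule K M) = eString (K := K) e m := rfl

/-- Membership in `eStringLieSubmodule` is membership in `eString`. -/
lemma mem_eStringLieSubmodule (P : HasLowestWeightVector t m μ)
    (hL : t.toLieSubalgebra K = ⊤) {v : M} :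
    v ∈ P.eStringLieSubmodule hL ↔ v ∈ eString (K := K) e m := Iff.rfl

/-- In an irreducible module over a Lie algebra spanned by the triple, the e-string of a
lowest-weight vector spans everything. -/
lemma eString_eq_top [LieModule.IsIrreducible K L M] (P : HasLowestWeightVector t m μ)
    (hL : t.toLieSubalgebra K = ⊤) : eString (K := K) e m = ⊤ := by
  have hne : P.eStringLieSubmodule hL ≠ ⊥ := by
    intro hbot
    have hm : m ∈ P.eStringLieSubmodule hL := (P.mem_eStringLieSubmodule hL).mpr (mem_eString e m)
    rw [hbot, LieSubmodule.mem_bot] at hm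
    exact P.ne_zero hm
  have htop : P.eStringLieSubmodule hL = ⊤ :=
    (IsSimpleOrder.eq_bot_or_eq_top (P.eStringLieSubmodule hL)).resolve_left hne
  rw [← P.coe_eStringLieSubmodule hL, htop, LieSubmodule.top_toSubmodule]

/-- The e-string spans: `⨆ n, K ∙ eⁿ m = ⊤`. -/
lemma iSup_span_singleton_eq_top [LieModule.IsIrreducible K L M]
    (P : HasLowestWeightVector t m μ) (hL : t.toLieSubalgebra K = ⊤) :
    ⨆ n : ℕ, (K ∙ (toEnd K L M e ^ n) m) = ⊤ := by
  rw [← Submodule.span_range_eq_iSup]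
  exact P.eString_eq_top hL

/-- The e-string as a **basis** of an irreducible lowest-weight module. -/
noncomputable def eStringBasis [CharZero K] [LieModule.IsIrreducible K L M]
    (P : HasLowestWeightVector t m μ)
    (hμ : ∀ n : ℕ, μ ≠ -(n : K)) (hL : t.toLieSubalgebra K = ⊤) : Module.Basis ℕ K M :=
  Module.Basis.mk (P.linearIndependent_pow_e hμ) (by
    rw [show Submodule.span K (Set.range fun n : ℕ => (toEnd K L M e ^ n) m) =
      eString (K := K) e m from rfl, P.eString_eq_top hL])

/-- The `n`-th basis vector of `eStringBasis` is `eⁿ m`. -/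
@[simp]
lemma eStringBasis_apply [CharZero K] [LieModule.IsIrreducible K L M]
    (P : HasLowestWeightVector t m μ)
    (hμ : ∀ n : ℕ, μ ≠ -(n : K)) (hL : t.toLieSubalgebra K = ⊤) (n : ℕ) :
    P.eStringBasis hμ hL n = (toEnd K L M e ^ n) m :=
  Module.Basis.mk_apply _ _ n

/-- The line `K ∙ eⁿ m` lies in the `h`-eigenspace of `μ + 2n`. -/
lemma span_singleton_pow_e_le_eigenspace (P : HasLowestWeightVector t m μ) (n : ℕ) :
    (K ∙ (toEnd K L M e ^ n) m) ≤ (toEnd K L M h).eigenspace (μ + 2 * n) :=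
  (Submodule.span_singleton_le_iff_mem _ _).mpr (P.pow_e_mem_eigenspace n)

/-- In an irreducible lowest-weight module, `c` is not of the form `μ + 2n` ⟹ the
`h`-eigenspace of `c` is `⊥`. -/
lemma eigenspace_eq_bot [LieModule.IsIrreducible K L M] (P : HasLowestWeightVector t m μ)
    (hL : t.toLieSubalgebra K = ⊤) {c : K} (hc : ∀ n : ℕ, c ≠ μ + 2 * n) :
    (toEnd K L M h).eigenspace c = ⊥ := by
  have hind : Disjoint ((toEnd K L M h).eigenspace c)
      (⨆ (c' : K) (_ : c' ≠ c), (toEnd K L M h).eigenspace c') :=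
    (toEnd K L M h).eigenspaces_iSupIndep c
  have hle : (⊤ : Submodule K M) ≤ ⨆ (c' : K) (_ : c' ≠ c), (toEnd K L M h).eigenspace c' := by
    rw [← P.iSup_span_singleton_eq_top hL]
    exact iSup_le fun n =>
      le_iSup₂_of_le (μ + 2 * n) (hc n).symm (P.span_singleton_pow_e_le_eigenspace n)
  exact (hind.mono_right hle).eq_bot_of_le le_top

/-- In an irreducible lowest-weight module (with `μ` not a non-positive integer), the
`h`-eigenspace of `μ + 2n` is exactly the line `K ∙ eⁿ m`. -/
lemma eigenspace_eq_span_singleton [CharZero K] [LieModule.IsIrreducible K L M]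
    (P : HasLowestWeightVector t m μ) (hL : t.toLieSubalgebra K = ⊤) (n : ℕ) :
    (toEnd K L M h).eigenspace (μ + 2 * n) = K ∙ (toEnd K L M e ^ n) m := by
  refine le_antisymm ?_ (P.span_singleton_pow_e_le_eigenspace n)
  intro v hv
  have hind : Disjoint ((toEnd K L M h).eigenspace (μ + 2 * n))
      (⨆ (c' : K) (_ : c' ≠ μ + 2 * n), (toEnd K L M h).eigenspace c') :=
    (toEnd K L M h).eigenspaces_iSupIndep (μ + 2 * n)
  have hrest : (⨆ (k : ℕ) (_ : k ≠ n), (K ∙ (toEnd K L M e ^ k) m)) ≤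
      ⨆ (c' : K) (_ : c' ≠ μ + 2 * n), (toEnd K L M h).eigenspace c' := by
    refine iSup₂_le fun k hk => ?_
    refine le_iSup₂_of_le (μ + 2 * k) (fun hkn => hk ((weight_injective μ) hkn))
      (P.span_singleton_pow_e_le_eigenspace k)
  have hsplit : (⊤ : Submodule K M) =
      (K ∙ (toEnd K L M e ^ n) m) ⊔ ⨆ (k : ℕ) (_ : k ≠ n), (K ∙ (toEnd K L M e ^ k) m) := by
    rw [← P.iSup_span_singleton_eq_top hL]
    exact iSup_split_single _ n
  obtain ⟨y, hy, z, hz, rfl⟩ := Submodule.mem_sup.mp (hsplit ▸ Submodule.mem_top (x := v))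
  have hz' : z ∈ (toEnd K L M h).eigenspace (μ + 2 * n) := by
    have hy' : y ∈ (toEnd K L M h).eigenspace (μ + 2 * n) :=
      P.span_singleton_pow_e_le_eigenspace n hy
    simpa using Submodule.sub_mem _ hv hy'
  have hz0 : z = 0 := (Submodule.disjoint_def.mp hind) z hz' (hrest hz)
  rw [hz0, add_zero]
  exact hy

/-- Multiplicity one: every `h`-eigenspace of an irreducible lowest-weight module has
dimension at most one. -/
lemma finrank_eigenspace_le_one [CharZero K] [LieModule.IsIrreducible K L M]
    (P : HasLowestWeightVector t m μ) (hL : t.toLieSubalgebra K = ⊤) (c : K) :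
    Module.finrank K ((toEnd K L M h).eigenspace c) ≤ 1 := by
  by_cases hc : ∃ n : ℕ, c = μ + 2 * n
  · obtain ⟨n, rfl⟩ := hc
    rw [P.eigenspace_eq_span_singleton hL n]
    exact (finrank_span_le_card ({(toEnd K L M e ^ n) m} : Set M)).trans (by simp)
  · rw [P.eigenspace_eq_bot hL fun n hn => hc ⟨n, hn⟩, finrank_bot]
    exact zero_le_one

/-- The weight `μ + 2n` occurs with multiplicity exactly one. -/
lemma finrank_eigenspace_eq_one [CharZero K] [LieModule.IsIrreducible K L M]
    (P : HasLowestWeightVector t m μ) (hμ : ∀ n : ℕ, μ ≠ -(n : K))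
    (hL : t.toLieSubalgebra K = ⊤) (n : ℕ) :
    Module.finrank K ((toEnd K L M h).eigenspace (μ + 2 * n)) = 1 := by
  rw [P.eigenspace_eq_span_singleton hL n]
  exact finrank_span_singleton (P.pow_e_ne_zero hμ n)

/-- The `h`-eigenvalues of an irreducible lowest-weight module are exactly `μ, μ + 2, μ + 4, …`. -/
lemma hasEigenvalue_iff [CharZero K] [LieModule.IsIrreducible K L M]
    (P : HasLowestWeightVector t m μ)
    (hμ : ∀ n : ℕ, μ ≠ -(n : K)) (hL : t.toLieSubalgebra K = ⊤) (c : K) :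
    (toEnd K L M h).HasEigenvalue c ↔ ∃ n : ℕ, c = μ + 2 * n := by
  constructor
  · intro hc
    by_contra hne
    exact hc (P.eigenspace_eq_bot hL fun n hn => hne ⟨n, hn⟩)
  · rintro ⟨n, rfl⟩
    exact Module.End.hasEigenvalue_of_hasEigenvector (P.hasEigenvector_pow_e hμ n)

/-- For lowest weight `3`: the `h`-eigenvalues are exactly `3, 5, 7, …` — the algebraic form of
«the SO(2)-weights of π₃⁺ are {3, 5, 7, …}». -/
lemma hasEigenvalue_iff_of_three [CharZero K] [LieModule.IsIrreducible K L M]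
    (P : HasLowestWeightVector t m (3 : K)) (hL : t.toLieSubalgebra K = ⊤) (c : K) :
    (toEnd K L M h).HasEigenvalue c ↔ ∃ n : ℕ, c = 3 + 2 * n :=
  P.hasEigenvalue_iff three_ne_neg hL c

/-- For lowest weight `3`: each weight `3 + 2n` occurs exactly once — «each once». -/
lemma finrank_eigenspace_eq_one_of_three [CharZero K] [LieModule.IsIrreducible K L M]
    (P : HasLowestWeightVector t m (3 : K)) (hL : t.toLieSubalgebra K = ⊤) (n : ℕ) :
    Module.finrank K ((toEnd K L M h).eigenspace (3 + 2 * n)) = 1 :=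
  P.finrank_eigenspace_eq_one three_ne_neg hL n

end HasLowestWeightVector

end Field

end Summit.Ventures.HodgeRepro2.T5Sl2LowestWeight
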